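import Summits.CriticalPhenomena.PercolationContinuityZ3.Theorems.PercNearOneGluingNoHeavyLowerTailAntitheticCycleReflect
import HarnessLib

/-!
# `NoHeavyLowerTail` (stmt-CriticalPhenomena-4575) — antithetic cluster pairs: RUN COORDINATES on a cycle, part 1 — run predicates and the
# FLIP of a run together with its stopper (prim-hp-2 gen 42; HOME/THEOREM-Cprime-delta2-cycle.md §2–§4, MEMO-gen42 §1)

Support file (`--supports stmt-CriticalPhenomena-4575`, hull-port prover `prim-hp-2`, gen 42).  No named facts, no sorries; standard axioms.  The `def`s
`Antithetic.Cyc.{preBlock, sufBlock, cwRun, ccwRun}` are proof-internal bookkeeping.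

SETTING (…AntitheticCycleRuns): cycle `v 0 = s, …, v (n−1)`, pairs `edge v k = v k v (k+1)`.  THEOREM C′ (and the run-coordinate re-proof of THEOREM C)
groups the colourings `ω` of the cycle by the colours `c, d` of the two `s`-pairs `edge 0`, `edge (n−1)` and the lengths `i, j` of the maximal
clockwise / counter-clockwise runs of those colours from `s`; a BULK class (`i + j ≤ n − 2`) consists of the four colourings obtained by flipping the
clockwise run together with its stopper pair `edge i` (`preBlock i`) and/or the counter-clockwise run with its stopper (`sufBlock j`).  This file
provides the bookkeeping:
* `Cyc.cwRun ω c i` / `Cyc.ccwRun ω d j` — "the clockwise run from `s` has colour `c` and length exactly `i`" (pairs `edge k`, `k < i`, have colour `c`,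
  the pair `edge i` — if `i < n` — has the other colour), and the counter-clockwise analogue;
* `Cyc.cwRun_pre` … — the run predicates determine `pre`/`suf` of `ω` and of `ωᶜ` (`Cyc.pre`, `Cyc.suf` of …CycleRuns);
* `Cyc.cwRun_flip`, `Cyc.ccwRun_flip` — flipping the run with its stopper reverses the colour and keeps the length;
* `Cyc.ccwRun_preBlock`, `Cyc.cwRun_sufBlock` — in the bulk (`i + j + 2 ≤ n`) the other run is untouched;
* `Cyc.exists_cwRun`, `Cyc.cwRun_unique` — every colouring has exactly one clockwise run datum (and likewise counter-clockwise).
[cite: VandenbergHaggstromKahn2005, §1 p. 3 (open cluster `C_s`)]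
-/

noncomputable section

namespace Summit.CriticalPhenomena.PercolationContinuityZ3.Theorems

open Literature.Probability.Percolation
open scoped Classical symmDiff

namespace Antithetic

namespace Cyc

variable {V : Type*} (n : ℕ) (v : ℕ → V)

/-- The clockwise block `{edge 0, …, edge m}` (a run of length `m` plus its stopper). [this work] -/
def preBlock (m : ℕ) : Set (Sym2 V) := {e | ∃ k, k ≤ m ∧ e = edge v k}

/-- The counter-clockwise block `{edge (n−1), …, edge (n−1−m)}`. [this work] -/
def sufBlock (m : ℕ) : Set (Sym2 V) := {e | ∃ k, k ≤ m ∧ e = edge v (n - 1 - k)}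

/-- The colourings whose clockwise run from `s` has colour `c` and length exactly `i`: the pairs `edge k`, `k < i`, have colour `c` (`∈ ω` iff `c`)
and, if `i < n`, the pair `edge i` has the other colour. [this work] -/
def cwRun (c : Prop) (i : ℕ) : Set (Set (Sym2 V)) :=
  {ω | (∀ k, k < i → (edge v k ∈ ω ↔ c)) ∧ (i < n → ¬ (edge v i ∈ ω ↔ c))}

/-- The counter-clockwise analogue of `cwRun` (pairs `edge (n−1−k)`). [this work] -/
def ccwRun (d : Prop) (j : ℕ) : Set (Set (Sym2 V)) :=
  {ω | (∀ k, k < j → (edge v (n - 1 - k) ∈ ω ↔ d)) ∧ (j < n → ¬ (edge v (n - 1 - j) ∈ ω ↔ d))}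

variable {n v}

section Runs

variable (ω : Set (Sym2 V))

/-- Membership in `cwRun`. [this work] -/
theorem mem_cwRun {c : Prop} {i : ℕ} :
    ω ∈ cwRun n v c i ↔ (∀ k, k < i → (edge v k ∈ ω ↔ c)) ∧ (i < n → ¬ (edge v i ∈ ω ↔ c)) := Iff.rfl

/-- Membership in `ccwRun`. [this work] -/
theorem mem_ccwRun {d : Prop} {j : ℕ} :
    ω ∈ ccwRun n v d j ↔ (∀ k, k < j → (edge v (n - 1 - k) ∈ ω ↔ d)) ∧ (j < n → ¬ (edge v (n - 1 - j) ∈ ω ↔ d)) := Iff.rfl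

/-- Flipping a set of pairs: membership. [folklore] -/
theorem mem_symmDiff_iff' {B : Set (Sym2 V)} {e : Sym2 V} : e ∈ ω ∆ B ↔ ((e ∈ ω) ↔ (e ∉ B)) := by
  rw [Set.mem_symmDiff]; tauto

/-- Flipping the same block twice is the identity. [folklore] -/
theorem symmDiff_symmDiff_self (B : Set (Sym2 V)) : (ω ∆ B) ∆ B = ω := by
  rw [symmDiff_assoc, symmDiff_self, symmDiff_bot]

/-- `pre` is determined by a red prefix of length `m` followed (if `m < n`) by a blue pair. [this work] -/
theorem pre_eq_of {m : ℕ} (hm : m ≤ n) (hred : ∀ k, k < m → edge v k ∈ ω) (hstop : m < n → edge v m ∉ ω) : pre n v ω = m := by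
  refine le_antisymm ?_ (le_pre ω hm hred)
  rcases Nat.lt_or_ge m n with h | h
  · exact Nat.find_le (Or.inr (hstop h))
  · exact (pre_le ω).trans h

/-- `suf` is determined by a red suffix of length `m` preceded (if `m < n`) by a blue pair. [this work] -/
theorem suf_eq_of {m : ℕ} (hm : m ≤ n) (hred : ∀ k, k < m → edge v (n - 1 - k) ∈ ω) (hstop : m < n → edge v (n - 1 - m) ∉ ω) :
    suf n v ω = m := by
  refine le_antisymm ?_ (le_suf ω hm hred)
  rcases Nat.lt_or_ge m n with h | h
  · exact Nat.find_le (Or.inr (hstop h))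
  · exact (suf_le ω).trans h

/-- A red clockwise run of length `i` gives `pre ω = i`. [this work] -/
theorem cwRun_pre {c : Prop} {i : ℕ} (h : ω ∈ cwRun n v c i) (hc : c) (hi : i ≤ n) : pre n v ω = i :=
  pre_eq_of ω hi (fun k hk => (h.1 k hk).2 hc) fun hin hmem => h.2 hin (iff_of_true hmem hc)

/-- A blue clockwise run of length `i` gives `pre ωᶜ = i`. [this work] -/
theorem cwRun_pre_compl {c : Prop} {i : ℕ} (h : ω ∈ cwRun n v c i) (hc : ¬ c) (hi : i ≤ n) : pre n v ωᶜ = i :=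
  pre_eq_of ωᶜ hi (fun k hk hmem => hc ((h.1 k hk).1 hmem)) fun hin hmem => h.2 hin (iff_of_false hmem hc)

/-- A clockwise run of positive length and colour `c`: the other colour has `pre = 0`. [this work] -/
theorem cwRun_pre_other {c : Prop} {i : ℕ} (h : ω ∈ cwRun n v c i) (hi : 0 < i) :
    (c → pre n v ωᶜ = 0) ∧ (¬ c → pre n v ω = 0) := by
  constructor
  · intro hc
    exact pre_eq_of ωᶜ (Nat.zero_le _) (fun k hk => absurd hk (Nat.not_lt_zero _)) fun _ hmem => hmem ((h.1 0 hi).2 hc)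
  · intro hc
    exact pre_eq_of ω (Nat.zero_le _) (fun k hk => absurd hk (Nat.not_lt_zero _)) fun _ hmem => hc ((h.1 0 hi).1 hmem)

/-- A red counter-clockwise run of length `j` gives `suf ω = j`. [this work] -/
theorem ccwRun_suf {d : Prop} {j : ℕ} (h : ω ∈ ccwRun n v d j) (hd : d) (hj : j ≤ n) : suf n v ω = j :=
  suf_eq_of ω hj (fun k hk => (h.1 k hk).2 hd) fun hjn hmem => h.2 hjn (iff_of_true hmem hd)

/-- A blue counter-clockwise run of length `j` gives `suf ωᶜ = j`. [this work] -/
theorem ccwRun_suf_compl {d : Prop} {j : ℕ} (h : ω ∈ ccwRun n v d j) (hd : ¬ d) (hj : j ≤ n) : suf n v ωᶜ = j :=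
  suf_eq_of ωᶜ hj (fun k hk hmem => hd ((h.1 k hk).1 hmem)) fun hjn hmem => h.2 hjn (iff_of_false hmem hd)

/-- A counter-clockwise run of positive length and colour `d`: the other colour has `suf = 0`. [this work] -/
theorem ccwRun_suf_other {d : Prop} {j : ℕ} (h : ω ∈ ccwRun n v d j) (hj : 0 < j) :
    (d → suf n v ωᶜ = 0) ∧ (¬ d → suf n v ω = 0) := by
  constructor
  · intro hd
    exact suf_eq_of ωᶜ (Nat.zero_le _) (fun k hk => absurd hk (Nat.not_lt_zero _)) fun _ hmem => hmem ((h.1 0 hj).2 hd)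
  · intro hd
    exact suf_eq_of ω (Nat.zero_le _) (fun k hk => absurd hk (Nat.not_lt_zero _)) fun _ hmem => hd ((h.1 0 hj).1 hmem)

/-- Every colouring has a clockwise run datum: colour = colour of `edge 0`, length = `pre ω` or `pre ωᶜ`. [this work] -/
theorem exists_cwRun : ∃ i, i ≤ n ∧ ω ∈ cwRun n v (edge v 0 ∈ ω) i := by
  by_cases h0 : edge v 0 ∈ ω
  · refine ⟨pre n v ω, pre_le ω, fun k hk => iff_of_true (red_of_lt_pre ω hk) h0, fun hin hiff => ?_⟩
    exact not_red_pre ω hin (hiff.2 h0)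
  · refine ⟨pre n v ωᶜ, pre_le ωᶜ, fun k hk => iff_of_false (fun hmem => red_of_lt_pre ωᶜ hk hmem) h0, fun hin hiff => ?_⟩
    exact not_red_pre ωᶜ hin (fun hmem => h0 (hiff.1 hmem))

/-- Every colouring has a counter-clockwise run datum. [this work] -/
theorem exists_ccwRun : ∃ j, j ≤ n ∧ ω ∈ ccwRun n v (edge v (n - 1) ∈ ω) j := by
  by_cases h0 : edge v (n - 1) ∈ ω
  · refine ⟨suf n v ω, suf_le ω, fun k hk => iff_of_true (red_of_lt_suf ω hk) h0, fun hjn hiff => ?_⟩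
    exact not_red_suf ω hjn (hiff.2 h0)
  · refine ⟨suf n v ωᶜ, suf_le ωᶜ, fun k hk => iff_of_false (fun hmem => red_of_lt_suf ωᶜ hk hmem) h0, fun hjn hiff => ?_⟩
    exact not_red_suf ωᶜ hjn (fun hmem => h0 (hiff.1 hmem))

/-- The length of the clockwise run is unique. [this work] -/
theorem cwRun_unique {c c' : Prop} {i i' : ℕ} (h : ω ∈ cwRun n v c i) (h' : ω ∈ cwRun n v c' i') (hi : i ≤ n) (hi' : i' ≤ n)
    (hc : c ↔ c') : i = i' := by
  -- both colours are the colour of `edge 0` unless the length is 0; compare the stoppers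
  by_contra hne
  rcases Nat.lt_or_gt_of_ne hne with hlt | hlt
  · -- i < i' ≤ n: pair `edge i` has colour c' = c by h', but the other colour by h
    exact h.2 (lt_of_lt_of_le hlt hi') ((h'.1 i hlt).trans hc.symm)
  · exact h'.2 (lt_of_lt_of_le hlt hi) ((h.1 i' hlt).trans hc)

/-- The length of the counter-clockwise run is unique. [this work] -/
theorem ccwRun_unique {d d' : Prop} {j j' : ℕ} (h : ω ∈ ccwRun n v d j) (h' : ω ∈ ccwRun n v d' j') (hj : j ≤ n) (hj' : j' ≤ n)
    (hd : d ↔ d') : j = j' := by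
  by_contra hne
  rcases Nat.lt_or_gt_of_ne hne with hlt | hlt
  · exact h.2 (lt_of_lt_of_le hlt hj') ((h'.1 j hlt).trans hd.symm)
  · exact h'.2 (lt_of_lt_of_le hlt hj) ((h.1 j' hlt).trans hd)

/-- Run data pass to the complement with the colour negated. [this work] -/
theorem cwRun_compl_iff {c : Prop} {i : ℕ} : ωᶜ ∈ cwRun n v (¬ c) i ↔ ω ∈ cwRun n v c i := by
  rw [mem_cwRun, mem_cwRun]
  refine and_congr (forall₂_congr fun k _ => ?_) (forall_congr' fun _ => ?_)
  · rw [Set.mem_compl_iff]; tauto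
  · rw [Set.mem_compl_iff]; tauto

/-- Pairs outside the cycle are untouched by the clockwise flip. [this work] -/
theorem mem_flip_preBlock_of_notMem {m : ℕ} {e : Sym2 V} (he : e ∉ edgeSet n v) (hm : m < n) : e ∈ ω ∆ preBlock v m ↔ e ∈ ω := by
  rw [mem_symmDiff_iff' ω]
  have : e ∉ preBlock v m := fun ⟨k, hk, hke⟩ => he ⟨k, lt_of_le_of_lt hk hm, hke⟩
  tauto

/-- Pairs outside the cycle are untouched by the counter-clockwise flip. [this work] -/
theorem mem_flip_sufBlock_of_notMem {m : ℕ} {e : Sym2 V} (he : e ∉ edgeSet n v) (hm : m < n) : e ∈ ω ∆ sufBlock n v m ↔ e ∈ ω := by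
  rw [mem_symmDiff_iff' ω]
  have : e ∉ sufBlock n v m := fun ⟨k, hk, hke⟩ => he ⟨n - 1 - k, by omega, hke⟩
  tauto

end Runs

section Flip

variable (hn : 3 ≤ n) (hinj : ∀ i j, i < n → j < n → v i = v j → i = j) (hper : v n = v 0)
include hn hinj hper

/-- Membership of a cycle pair in the clockwise block. [this work] -/
theorem edge_mem_preBlock_iff {m k : ℕ} (hm : m < n) (hk : k < n) : edge v k ∈ preBlock v m ↔ k ≤ m := by
  constructor
  · rintro ⟨k', hk', hkk'⟩
    rwa [edge_inj hn hinj hper hk (lt_of_le_of_lt hk' hm) hkk']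
  · exact fun h => ⟨k, h, rfl⟩

/-- Membership of a cycle pair in the counter-clockwise block. [this work] -/
theorem edge_mem_sufBlock_iff {m k : ℕ} (hm : m < n) (hk : k < n) : edge v k ∈ sufBlock n v m ↔ n - 1 - m ≤ k := by
  constructor
  · rintro ⟨k', hk', hkk'⟩
    rw [edge_inj hn hinj hper hk (by omega) hkk']
    omega
  · exact fun h => ⟨n - 1 - k, by omega, by congr 1; omega⟩

variable (ω : Set (Sym2 V))

/-- **Flipping the clockwise run with its stopper** reverses its colour and keeps its length. [this work] -/
theorem cwRun_flip {c : Prop} {i : ℕ} (h : ω ∈ cwRun n v c i) (hi : i < n) : (ω ∆ preBlock v i) ∈ cwRun n v (¬ c) i := by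
  refine ⟨fun k hk => ?_, fun _ => ?_⟩
  · rw [mem_symmDiff_iff' ω, edge_mem_preBlock_iff hn hinj hper hi (hk.trans hi)]
    have := h.1 k hk
    have hki : k ≤ i := hk.le
    tauto
  · rw [mem_symmDiff_iff' ω, edge_mem_preBlock_iff hn hinj hper hi hi]
    have := h.2 hi
    have hii : i ≤ i := le_rfl
    tauto

/-- **Flipping the counter-clockwise run with its stopper** reverses its colour and keeps its length. [this work] -/
theorem ccwRun_flip {d : Prop} {j : ℕ} (h : ω ∈ ccwRun n v d j) (hj : j < n) : (ω ∆ sufBlock n v j) ∈ ccwRun n v (¬ d) j := by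
  refine ⟨fun k hk => ?_, fun _ => ?_⟩
  · rw [mem_symmDiff_iff' ω, edge_mem_sufBlock_iff hn hinj hper hj (by omega)]
    have := h.1 k hk
    have hkj : n - 1 - j ≤ n - 1 - k := by omega
    tauto
  · rw [mem_symmDiff_iff' ω, edge_mem_sufBlock_iff hn hinj hper hj (by omega)]
    have := h.2 hj
    have hle : n - 1 - j ≤ n - 1 - j := le_rfl
    tauto

/-- In the bulk (`i + j + 2 ≤ n`) the clockwise flip does not touch the counter-clockwise run datum. [this work] -/
theorem ccwRun_preBlock {i : ℕ} {d : Prop} {j : ℕ} (h : ω ∈ ccwRun n v d j) (hij : i + j + 2 ≤ n) :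
    (ω ∆ preBlock v i) ∈ ccwRun n v d j := by
  have hi : i < n := by omega
  refine ⟨fun k hk => ?_, fun hj => ?_⟩
  · rw [mem_symmDiff_iff' ω, edge_mem_preBlock_iff hn hinj hper hi (by omega)]
    have := h.1 k hk
    have hgt : ¬ (n - 1 - k ≤ i) := by omega
    tauto
  · rw [mem_symmDiff_iff' ω, edge_mem_preBlock_iff hn hinj hper hi (by omega)]
    have := h.2 hj
    have hgt : ¬ (n - 1 - j ≤ i) := by omega
    tauto

/-- In the bulk (`i + j + 2 ≤ n`) the counter-clockwise flip does not touch the clockwise run datum. [this work] -/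
theorem cwRun_sufBlock {c : Prop} {i : ℕ} {j : ℕ} (h : ω ∈ cwRun n v c i) (hij : i + j + 2 ≤ n) :
    (ω ∆ sufBlock n v j) ∈ cwRun n v c i := by
  have hj : j < n := by omega
  refine ⟨fun k hk => ?_, fun hi => ?_⟩
  · rw [mem_symmDiff_iff' ω, edge_mem_sufBlock_iff hn hinj hper hj (by omega)]
    have := h.1 k hk
    have hgt : ¬ (n - 1 - j ≤ k) := by omega
    tauto
  · rw [mem_symmDiff_iff' ω, edge_mem_sufBlock_iff hn hinj hper hj hi]
    have := h.2 hi
    have hgt : ¬ (n - 1 - j ≤ i) := by omega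
    tauto

end Flip

end Cyc

end Antithetic

end Summit.CriticalPhenomena.PercolationContinuityZ3.Theorems
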